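import Summits.KontsevichZagierPeriods.KontsevichZagierPeriods.Theorems.LinRedNormalFormHoffmanSpanInKZCertCheck

/-!
# Crux `LinRedNormalForm.HoffmanSpanInKZ` (stmt-KontsevichZagierPeriods-15044), line `Sketch`:
# certificate tables WITH REFERENCES (registered stub `stub_refCert`)

A flat EDS certificate (`Cert`) expresses ONE admissible word over the Hoffman words by an explicit
rational combination of relation vectors; from weight `9` on the flat tables are large (every word
needs `≈ 2^{N-2}` relation vectors, each expanding to up to `binom N 2` words). A certificate WITH
REFERENCES (`RCert`) may in addition cite, with rational coefficients, words certified EARLIER in the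
table (field `P`): the row identity checked by the kernel is
`e_w − Σ_P p·e_{w_p} − Σ_H h·e_h = Σ_F f·fdsVec + Σ_D d·hoffmanVec + Σ_K k·dualVec`,
and soundness (`edsCertificate_of_rtable`) assembles the `EdsCertificate` clause of `w` from the row
and the clauses of the cited words (the clause predicate `Clause N v` is closed under `0`, `+` and
rational scaling: `clause_zero`, `clause_add`, `clause_smul`). A table is checked row by row
(`rtableOk`, threading the list of words already certified; radix zero test `zeroTest` of
`LinRedNormalFormHoffmanSpanInKZCertCheck`). Typical rows: a dual word costs one reference and one
duality vector; a Gaussian-elimination transcript costs one relation vector plus references.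

Sources: K. Ihara, M. Kaneko, D. Zagier, Compos. Math. 142 (2006), §1; the reflection set-up of
`MzvKernelInKZTwoPosetsEdsCertificateLow` (this tree).
-/

namespace Summit.KontsevichZagierPeriods.LinRedNormalForm.HoffmanSpanInKZ

open Literature.NumberTheory.Transcendental
open Summit.KontsevichZagierPeriods.MzvKernelInKZ.Negative
open Summit.KontsevichZagierPeriods.MzvKernelInKZ.TwoPosets

/-! ## The clause predicate and its closure properties -/

section Clause

variable {N : ℕ}

/-- The `EdsCertificate` clause for a coefficient vector `v`: `v` is an explicit rational
combination of Hoffman words of weight `N` modulo finite-double-shuffle, Hoffman-relation and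
duality vectors (so that `EdsCertificate N ↔ ∀ ε, Adm ε → Clause N (unitVec N ε)`). -/
def Clause (N : ℕ) (v : Vec N) : Prop :=
  ∃ (H : List (List ℕ × ℚ)) (F : List ((List ℕ × List ℕ) × ℚ)) (D : List (List ℕ × ℚ))
    (K : List ((Fin N → Bool) × ℚ)),
    (∀ p ∈ H, MZV.IsHoffman p.1 ∧ MZV.weight p.1 = N) ∧
    (∀ p ∈ F, MZV.IsAdmissible p.1.1 ∧ MZV.IsAdmissible p.1.2 ∧ p.1.1 ≠ [] ∧ p.1.2 ≠ [] ∧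
      MZV.weight p.1.1 + MZV.weight p.1.2 = N) ∧
    (∀ p ∈ D, MZV.IsAdmissible p.1 ∧ MZV.weight p.1 + 1 = N) ∧
    (∀ p ∈ K, Adm p.1) ∧
    v - (H.map fun p => p.2 • unitVec N (bword N p.1)).sum =
      (F.map fun p => p.2 • fdsVec N p.1.1 p.1.2).sum +
        (D.map fun p => p.2 • hoffmanVec N p.1).sum + (K.map fun p => p.2 • dualVec N p.1).sum

/-- `EdsCertificate N` is the clause for every admissible unit vector (definitional). -/
theorem edsCertificate_iff_clause : EdsCertificate N ↔ ∀ ε : Fin N → Bool, Adm ε → Clause N (unitVec N ε) :=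
  Iff.rfl

/-- The zero vector has the empty clause. -/
theorem clause_zero : Clause N 0 :=
  ⟨[], [], [], [], by simp, by simp, by simp, by simp, by simp⟩

/-- Clauses add (concatenate the lists). -/
theorem clause_add {v w : Vec N} (hv : Clause N v) (hw : Clause N w) : Clause N (v + w) := by
  obtain ⟨H₁, F₁, D₁, K₁, hH₁, hF₁, hD₁, hK₁, e₁⟩ := hv
  obtain ⟨H₂, F₂, D₂, K₂, hH₂, hF₂, hD₂, hK₂, e₂⟩ := hw
  refine ⟨H₁ ++ H₂, F₁ ++ F₂, D₁ ++ D₂, K₁ ++ K₂, ?_, ?_, ?_, ?_, ?_⟩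
  · intro p hp; rcases List.mem_append.1 hp with h | h; exacts [hH₁ p h, hH₂ p h]
  · intro p hp; rcases List.mem_append.1 hp with h | h; exacts [hF₁ p h, hF₂ p h]
  · intro p hp; rcases List.mem_append.1 hp with h | h; exacts [hD₁ p h, hD₂ p h]
  · intro p hp; rcases List.mem_append.1 hp with h | h; exacts [hK₁ p h, hK₂ p h]
  · simp only [List.map_append, List.sum_append]
    have : v + w - ((H₁.map fun p => p.2 • unitVec N (bword N p.1)).sum +
        (H₂.map fun p => p.2 • unitVec N (bword N p.1)).sum) =
        (v - (H₁.map fun p => p.2 • unitVec N (bword N p.1)).sum) +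
          (w - (H₂.map fun p => p.2 • unitVec N (bword N p.1)).sum) := by abel
    rw [this, e₁, e₂]
    abel

/-- Scaling a coefficient list scales the realised sum. -/
theorem sum_map_scale {α : Type*} (q : ℚ) (L : List (α × ℚ)) (f : α → Vec N) :
    ((L.map fun p => (p.1, q * p.2)).map fun p => p.2 • f p.1).sum = q • (L.map fun p => p.2 • f p.1).sum := by
  induction L with
  | nil => simp
  | cons a L ih =>
    simp only [List.map_cons, List.sum_cons, smul_add, ih, mul_smul]

/-- Clauses scale (multiply every coefficient). -/
theorem clause_smul (q : ℚ) {v : Vec N} (hv : Clause N v) : Clause N (q • v) := by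
  obtain ⟨H, F, D, K, hH, hF, hD, hK, e⟩ := hv
  refine ⟨H.map fun p => (p.1, q * p.2), F.map fun p => (p.1, q * p.2), D.map fun p => (p.1, q * p.2),
    K.map fun p => (p.1, q * p.2), ?_, ?_, ?_, ?_, ?_⟩
  · intro p hp; obtain ⟨p', h', rfl⟩ := List.mem_map.1 hp; exact hH p' h'
  · intro p hp; obtain ⟨p', h', rfl⟩ := List.mem_map.1 hp; exact hF p' h'
  · intro p hp; obtain ⟨p', h', rfl⟩ := List.mem_map.1 hp; exact hD p' h'
  · intro p hp; obtain ⟨p', h', rfl⟩ := List.mem_map.1 hp; exact hK p' h'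
  · rw [sum_map_scale q H fun a => unitVec N (bword N a),
      sum_map_scale q F fun a => fdsVec N a.1 a.2, sum_map_scale q D fun a => hoffmanVec N a,
      sum_map_scale q K fun a => dualVec N a, ← smul_sub, e, smul_add, smul_add]

/-- A rational combination of vectors with clauses has a clause. -/
theorem clause_sum_refs (P : List (List ℕ × ℚ))
    (h : ∀ p ∈ P, Clause N (unitVec N (bword N p.1))) :
    Clause N (P.map fun p => p.2 • unitVec N (bword N p.1)).sum := by
  induction P with
  | nil => simpa using (clause_zero (N := N))
  | cons a P ih =>
    rw [List.map_cons, List.sum_cons]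
    exact clause_add (clause_smul a.2 (h a (by simp))) (ih fun p hp => h p (by simp [hp]))

end Clause

/-! ## Certificates with references -/

/-- A certificate with references: the word `w` (as an index), cited earlier words `P` with
coefficients, Hoffman coefficients `H`, double-shuffle pairs `F`, Hoffman-relation indices `D`,
duality words `K` (as indices). -/
structure RCert where
  /-- the word, as an index -/
  w : List ℕ
  /-- cited words (as indices), certified earlier in the table, with coefficients -/
  P : List (List ℕ × ℚ)
  /-- Hoffman indices of weight `N` with coefficients -/
  H : List (List ℕ × ℚ)
  /-- pairs of non-empty admissible indices of total weight `N` with coefficients -/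
  F : List ((List ℕ × List ℕ) × ℚ)
  /-- admissible indices of weight `N - 1` with coefficients -/
  D : List (List ℕ × ℚ)
  /-- admissible words (as indices) with coefficients -/
  K : List (List ℕ × ℚ)

/-- The flat part of a certificate with references (everything but `P`). -/
def RCert.flat (c : RCert) : Cert := ⟨c.w, c.H, c.F, c.D, c.K⟩

/-- The formal expansion of the row identity `e_w − Σ_P − Σ_H − (Σ_F + Σ_D + Σ_K)`. -/
def RCert.fvec (N : ℕ) (c : RCert) : FVec :=
  (c.P.map fun p => (MZV.binaryWord p.1, -p.2)) ++ c.flat.fvec N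

/-- The row checker: side conditions on `H, F, D, K` (as in `certOk₂`), every cited word occurs in
the list `prev` of words already certified, and the row identity holds (radix zero test). -/
def rcertOk (N : ℕ) (prev : List (List ℕ)) (c : RCert) : Bool :=
  decide (∀ p ∈ c.H, MZV.IsHoffman p.1 ∧ MZV.weight p.1 = N) &&
  decide (∀ p ∈ c.F, MZV.IsAdmissible p.1.1 ∧ MZV.IsAdmissible p.1.2 ∧ p.1.1 ≠ [] ∧ p.1.2 ≠ [] ∧
    MZV.weight p.1.1 + MZV.weight p.1.2 = N) &&
  decide (∀ p ∈ c.D, MZV.IsAdmissible p.1 ∧ MZV.weight p.1 + 1 = N) &&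
  decide (∀ p ∈ c.K, Adm (bword N p.1)) &&
  c.P.all (fun p => prev.contains p.1) && zeroTest N (c.fvec N)

/-- The table checker: rows in order, each checked against the words certified before it. -/
def rtableOk (N : ℕ) : List (List ℕ) → List RCert → Bool
  | _, [] => true
  | prev, c :: T => rcertOk N prev c && rtableOk N (c.w :: prev) T

/-- The realised row expansion: the flat expansion minus the cited part. -/
theorem RCert.eval_fvec (N : ℕ) (c : RCert) :
    FVec.eval N (c.fvec N) = FVec.eval N (c.flat.fvec N) -
      (c.P.map fun p => p.2 • unitVec N (bword N p.1)).sum := by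
  rw [RCert.fvec, FVec.eval_append, FVec.eval_map]
  have : (c.P.map fun p => (-p.2) • unitVec N (wordOf N (MZV.binaryWord p.1))).sum =
      -(c.P.map fun p => p.2 • unitVec N (bword N p.1)).sum := by
    rw [← Cert.sum_map_neg]
    congr 1
    exact List.map_congr_left fun p _ => by rw [neg_smul]; rfl
  simp only [this]
  abel

/-- **Soundness of one row**: a checked row whose cited words all have clauses gives the clause of
its word. -/
theorem clause_of_rcertOk (N : ℕ) (prev : List (List ℕ)) (c : RCert) (h : rcertOk N prev c = true)
    (hprev : ∀ w ∈ prev, Clause N (unitVec N (bword N w))) : Clause N (unitVec N (bword N c.w)) := by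
  simp only [rcertOk, Bool.and_eq_true, decide_eq_true_eq, List.all_eq_true] at h
  obtain ⟨⟨⟨⟨⟨hH, hF⟩, hD⟩, hK⟩, hP⟩, hz⟩ := h
  -- the cited part has a clause
  have hcited : Clause N (c.P.map fun p => p.2 • unitVec N (bword N p.1)).sum := by
    refine clause_sum_refs c.P fun p hp => hprev p.1 ?_
    exact List.contains_iff_mem.1 (hP p hp)
  -- the flat part: `e_w − Σ_P` has the explicit clause `(H, F, D, K)`
  have hflat : Clause N (unitVec N (bword N c.w) - (c.P.map fun p => p.2 • unitVec N (bword N p.1)).sum) := by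
    refine ⟨c.H, c.F, c.D, c.K.map fun p => (bword N p.1, p.2), hH, hF, hD, ?_, ?_⟩
    · intro p hp
      obtain ⟨q, hq, rfl⟩ := List.mem_map.1 hp
      exact hK q hq
    · have h0 := eval_eq_zero_of_zeroTest N hz
      rw [RCert.eval_fvec, Cert.eval_fvec] at h0
      have h1 : unitVec N (bword N c.w) - (c.P.map fun p => p.2 • unitVec N (bword N p.1)).sum -
          (c.H.map fun p => p.2 • unitVec N (bword N p.1)).sum =
          (c.F.map fun p => p.2 • fdsVec N p.1.1 p.1.2).sum +
            (c.D.map fun p => p.2 • hoffmanVec N p.1).sum +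
            (c.K.map fun p => p.2 • dualVec N (bword N p.1)).sum := by
        rw [← sub_eq_zero, ← h0]
        simp only [RCert.flat]
        abel
      rw [h1, List.map_map]
      rfl
  have := clause_add hflat hcited
  rwa [sub_add_cancel] at this

/-- **Soundness of the table checker**: every word of a checked table has a clause, provided the
words assumed certified at the start do. -/
theorem clause_of_rtableOk (N : ℕ) :
    ∀ (T : List RCert) (prev : List (List ℕ)), (∀ w ∈ prev, Clause N (unitVec N (bword N w))) →
      rtableOk N prev T = true → ∀ c ∈ T, Clause N (unitVec N (bword N c.w)) := by
  intro T
  induction T with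
  | nil => intro _ _ _ c hc; simp at hc
  | cons c T ih =>
    intro prev hprev h c' hc'
    simp only [rtableOk, Bool.and_eq_true] at h
    obtain ⟨hc, hT⟩ := h
    have hcw : Clause N (unitVec N (bword N c.w)) := clause_of_rcertOk N prev c hc hprev
    rcases List.mem_cons.1 hc' with rfl | hmem
    · exact hcw
    · refine ih (c.w :: prev) ?_ hT c' hmem
      intro w hw
      rcases List.mem_cons.1 hw with rfl | hw'
      exacts [hcw, hprev w hw']

/-- **From a checked table with references to `EdsCertificate N`.** -/
theorem edsCertificate_of_rtable (N : ℕ) (T : List RCert) (hT : rtableOk N [] T = true)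
    (hcover : ∀ ε : Fin N → Bool, Adm ε → ∃ c ∈ T, bword N c.w = ε) : EdsCertificate N := by
  intro ε hε
  obtain ⟨c, hc, rfl⟩ := hcover ε hε
  exact clause_of_rtableOk N T [] (fun w hw => by simp at hw) hT c hc

/-- Splitting a table check at an append (so that long tables can be checked chunk by chunk, each
chunk against the explicit list of words certified before it). -/
theorem rtableOk_append (N : ℕ) :
    ∀ (T₁ T₂ : List RCert) (prev : List (List ℕ)),
      rtableOk N prev T₁ = true → rtableOk N ((T₁.map RCert.w).reverse ++ prev) T₂ = true →
        rtableOk N prev (T₁ ++ T₂) = true := by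
  intro T₁
  induction T₁ with
  | nil => intro T₂ prev _ h; simpa using h
  | cons c T₁ ih =>
    intro T₂ prev h₁ h₂
    simp only [rtableOk, List.cons_append, Bool.and_eq_true] at h₁ ⊢
    refine ⟨h₁.1, ih T₂ (c.w :: prev) h₁.2 ?_⟩
    simpa [List.map_cons, List.reverse_cons, List.append_assoc] using h₂

/-- **Coverage through word lists** (cheaper for the kernel than comparing functions): if every
admissible word, written as a list, is the binary word of some row, the table covers every
admissible word. -/
theorem rcover_of_lists (N : ℕ) (T : List RCert)
    (h : ∀ ε : Fin N → Bool, Adm ε → List.ofFn ε ∈ T.map fun c => MZV.binaryWord c.w) :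
    ∀ ε : Fin N → Bool, Adm ε → ∃ c ∈ T, bword N c.w = ε := by
  intro ε hε
  obtain ⟨c, hc, hcw⟩ := List.mem_map.1 (h ε hε)
  refine ⟨c, hc, ?_⟩
  change wordOf N (MZV.binaryWord c.w) = ε
  rw [hcw, wordOf_ofFn]

/-- The same coverage transfer for flat tables (`Cert`). -/
theorem cover_of_lists (N : ℕ) (T : List Cert)
    (h : ∀ ε : Fin N → Bool, Adm ε → List.ofFn ε ∈ T.map fun c => MZV.binaryWord c.w) :
    ∀ ε : Fin N → Bool, Adm ε → ∃ c ∈ T, bword N c.w = ε := by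
  intro ε hε
  obtain ⟨c, hc, hcw⟩ := List.mem_map.1 (h ε hε)
  refine ⟨c, hc, ?_⟩
  change wordOf N (MZV.binaryWord c.w) = ε
  rw [hcw, wordOf_ofFn]

/-! ## The registered stub -/

/-- Soundness of tables with references, as a statement. -/
def RefCertSound : Prop :=
  ∀ (N : ℕ) (T : List RCert), rtableOk N [] T = true →
    (∀ ε : Fin N → Bool, Adm ε → ∃ c ∈ T, bword N c.w = ε) → EdsCertificate N

/-- **Registered stub `stub_refCert`** of the skeleton of line `Sketch`. -/
theorem stub_refCert : RefCertSound := edsCertificate_of_rtable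

/-- Smoke test (kernel): the weight-`4` reductions as a table with references — `ζ(3,1)` flat,
`ζ(4)` citing `ζ(3,1)` through the double shuffle `ζ(4) = 4ζ(3,1)`, `ζ(2,1,1)` citing `ζ(4)` through
duality. -/
example : rtableOk 4 []
    [⟨[3, 1], [], [([2, 2], 1/3)], [(([2], [2]), 1/3)], [([3], 1/3)], []⟩,
     ⟨[4], [([3, 1], 4)], [], [(([2], [2]), -1)], [], []⟩,
     ⟨[2, 1, 1], [([4], 1)], [], [], [], [([2, 1, 1], 1)]⟩] = true := by
  decide +kernel

end Summit.KontsevichZagierPeriods.LinRedNormalForm.HoffmanSpanInKZ
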